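import Summits.PneNP.PneNP.Theorems.ChebyshevTracialDesignRungAssembly
import Summits.PneNP.PneNP.Theorems.ChebyshevTracialDesignCommutative
import Summits.PneNP.PneNP.Theorems.ChebyshevTracialDesignBlockDiagonal
import HarnessLib

/-!
# Cell pnp-psdrank, route `ChebyshevTracialDesign`: what the `r = 1` rung gives toward the crux, by name — dimension one, commutative
# strategies of every dimension, bounded-dimension blocks (all modulo Keevash–Lifshitz Thm 1.8)

Harmonic backbone of the crux `TracialDecayExp20` (stmt-PneNP-19878), brick 33 (prover g8). With `rectangleDecayExp_of_globalLevelD` (brick 32)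
in the tree, the route's earlier SHADOW files become theorems modulo `GlobalLevelDInequality`:
* `tracialDecayExp_dimOne_of_globalLevelD` — the crux's inequality in dimension `r = 1` (`…DimensionOne.tracialValueLEAt_one_iff`), with ONE rate `a`
  and NO dimension budget;
* `tracialDecayExp_commutative_of_globalLevelD` — the crux's inequality for COMMUTATIVE tight psd rectangles of EVERY dimension `r ≥ 1` (common
  orthonormal eigenbasis; `…Commutative.commutative_of_dimensionOne`), same rate, no budget: the dimension budget of the crux is idle on the LP-like
  sub-class;
* `tracialDecayExp_blockDiagonal_of_globalLevelD` — for block-diagonal tight psd rectangles of every dimension whose blocks have dimension `≤ d₀`,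
  rate `a/(8(d₀+1))` (`…BlockDiag….blockDiagonal_of_smallDimension` on top of `tracialDecayExp_boundedDim_of_globalLevelD`).
So, modulo KL Thm 1.8, the open content of `TracialDecayExp20` is exactly: genuinely non-commutative strategies whose irreducible blocks grow with `n`
(up to `r² n < exp(a·dq n)`). [cite: Rothvoss2017, §2 (PDF pp. 6–7)] [cite: BrietDadushPokutta2014, Thm. 6 (§3)] [cite: KeevashLifshitz2023, Thm. 1.8]
Stature: support/instrument, CONDITIONAL on `GlobalLevelDInequality`. WHAT THIS IS NOT: not the crux, nothing on psd rank of P_PM, no P-vs-NP content.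
Supports stmt-PneNP-19878.
-/

set_option linter.dupNamespace false -- `Summit.PneNP.PneNP.…`: summit = sub-problem (D-0017)

noncomputable section

namespace Summit.PneNP.PneNP.Theorems.ChebyshevTracialDesignRungCorollaries

open Finset Matrix Literature.Barriers.PneNP Literature.Combinatorics.Optimization
open Literature.Combinatorics.Additive.KeevashLifshitz
open Summit.PneNP.PneNP.Theorems.ChebyshevTracialDesignDimensionOne (tracialValueLEAt_one_iff)
open Summit.PneNP.PneNP.Theorems.ChebyshevTracialDesignCommutative (commutative_of_dimensionOne)
open Summit.PneNP.PneNP.Theorems.ChebyshevTracialDesignBlockDiagonal (blockDiagonal_of_smallDimension)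
open Summit.PneNP.PneNP.Theorems.ChebyshevTracialDesignRungAssembly

variable {n : ℕ}

/-- **The crux in dimension one, modulo KL Thm 1.8**: for some `a > 0` and all large even `n`, every balanced `B = 20` design weight of degree
`dq n` has tracial value `≤ exp(−a·dq n)` on tight psd rectangles of dimension `1` — with no dimension budget. [cite: Rothvoss2017, §2 (PDF p. 6)] -/
theorem tracialDecayExp_dimOne_of_globalLevelD (hKL : GlobalLevelDInequality) :
    ∃ a : ℝ, 0 < a ∧ ∃ n₁ : ℕ, ∀ n : ℕ, n₁ ≤ n → Even n → ∀ (t : ℕ) (C : Finset ℕ) (w : ℕ → ℝ),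
      IsBalancedDesign n t (Tq n) (dq n) 20 C w →
        TracialValueLEAt (levelWeight n t C w) (Real.exp (-(a * (dq n : ℝ)))) 1 := by
  obtain ⟨a, ha, n₁, h⟩ := rectangleDecayExp_of_globalLevelD hKL
  exact ⟨a, ha, n₁, fun n hn hev t C w hdes => (tracialValueLEAt_one_iff _ _).2 (h n hn hev t C w hdes)⟩

/-- **The crux on COMMUTATIVE strategies of every dimension, modulo KL Thm 1.8**: for some `a > 0` and all large even `n`, every balanced
`B = 20` design weight of degree `dq n` has normalised value `≤ exp(−a·dq n)` on every tight psd rectangle of any dimension `r ≥ 1` whose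
`X_U`, `Y_M` have a common orthonormal eigenbasis (`X_U = O·diag(x_U)·Oᵀ`, `Y_M = O·diag(y_M)·Oᵀ`, `OᵀO = I`). No condition `r²n < exp(a·dq n)`.
[cite: Rothvoss2017, §2 (PDF pp. 6–7)] [cite: BrietDadushPokutta2014, Thm. 6 (§3)] -/
theorem tracialDecayExp_commutative_of_globalLevelD (hKL : GlobalLevelDInequality) :
    ∃ a : ℝ, 0 < a ∧ ∃ n₁ : ℕ, ∀ n : ℕ, n₁ ≤ n → Even n → ∀ (t : ℕ) (C : Finset ℕ) (w : ℕ → ℝ),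
      IsBalancedDesign n t (Tq n) (dq n) 20 C w → ∀ (r : ℕ), 0 < r →
        ∀ (O : Matrix (Fin r) (Fin r) ℝ), Oᵀ * O = 1 → ∀ (x : OddSet n → Fin r → ℝ) (y : PMatch n → Fin r → ℝ)
          (X : OddSet n → Matrix (Fin r) (Fin r) ℝ) (Y : PMatch n → Matrix (Fin r) (Fin r) ℝ),
          (∀ U, X U = O * diagonal (x U) * Oᵀ) → (∀ M, Y M = O * diagonal (y M) * Oᵀ) → IsPsdRect X Y →
            (∑ U, ∑ M, levelWeight n t C w U M * (X U * Y M).trace) / r ≤ Real.exp (-(a * (dq n : ℝ))) := by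
  obtain ⟨a, ha, n₁, h⟩ := tracialDecayExp_dimOne_of_globalLevelD hKL
  exact ⟨a, ha, n₁, fun n hn hev t C w hdes r hr O hO x y X Y hX hY hXY =>
    commutative_of_dimensionOne hr C w _ (h n hn hev t C w hdes) O hO x y hX hY hXY⟩

/-- **The crux on BLOCK-DIAGONAL strategies with bounded blocks, modulo KL Thm 1.8**: for some `a > 0` and every `d₀`, for all large even `n`,
every balanced `B = 20` design weight of degree `dq n` has normalised value `≤ exp(−(a/(8(d₀+1)))·dq n)` on every tight psd rectangle of any
dimension `r ≥ 1` that is block-diagonal (`X_U i j = Y_M i j = 0` across blocks) with blocks of dimension `≤ d₀`. [cite: Rothvoss2017, §2 (PDF p. 6)] -/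
theorem tracialDecayExp_blockDiagonal_of_globalLevelD (hKL : GlobalLevelDInequality) :
    ∃ a : ℝ, 0 < a ∧ ∀ d₀ : ℕ, ∃ n₁ : ℕ, ∀ n : ℕ, n₁ ≤ n → Even n → ∀ (t : ℕ) (C : Finset ℕ) (w : ℕ → ℝ),
      IsBalancedDesign n t (Tq n) (dq n) 20 C w → ∀ (r m : ℕ), 0 < r → ∀ (blk : Fin r → Fin m),
        (∀ b : Fin m, Fintype.card {i : Fin r // blk i = b} ≤ d₀) →
        ∀ (X : OddSet n → Matrix (Fin r) (Fin r) ℝ) (Y : PMatch n → Matrix (Fin r) (Fin r) ℝ), IsPsdRect X Y →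
          (∀ U i j, blk i ≠ blk j → X U i j = 0) → (∀ M i j, blk i ≠ blk j → Y M i j = 0) →
            (∑ U, ∑ M, levelWeight n t C w U M * (X U * Y M).trace) / r ≤
              Real.exp (-(a / (8 * ((d₀ : ℝ) + 1)) * (dq n : ℝ))) := by
  obtain ⟨a, ha, h⟩ := tracialDecayExp_boundedDim_of_globalLevelD hKL
  refine ⟨a, ha, fun d₀ => ?_⟩
  obtain ⟨n₁, hn₁⟩ := h d₀
  refine ⟨n₁, fun n hn hev t C w hdes r m hr blk hsmall X Y hXY hX hY => ?_⟩
  refine blockDiagonal_of_smallDimension hr C w _ d₀ (fun d hd => ?_) blk hsmall hXY hX hY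
  rcases Nat.eq_zero_or_pos d with rfl | hd0
  · -- dimension `0`: the value is an empty sum
    intro X' Y' _
    simp only [Nat.cast_zero, div_zero]
    positivity
  · exact hn₁ n hn hev t C w hdes d hd0 hd

end Summit.PneNP.PneNP.Theorems.ChebyshevTracialDesignRungCorollaries
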